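import Summits.CriticalPhenomena.PercolationContinuityZ3.Theorems.PercNearOneGluingNoHeavyPcintNawRandMemSym
import HarnessLib

/-!
# PCINT lane, reduction B2c (chain bookkeeping) on the memory-`τ` DANGEROUS-SET automaton — definitions

Cell `prim-pcint` (PAPER-2 track (iii)), seat `prim-pcint-1` (gen 5); support file (`--supports stmt-CriticalPhenomena-4575`).
Does NOT build on p205010.  Memo: run/shared/lean/prim/pcint/REDUCTIONS.md §B2c (prim-pcint-2 gen 3: every INCIDENCE of a forced
site pays `q = (1-p)^{1/(2d)}` once; window rule §B2c.2, reduced-state visibility §B2c.7).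

The automaton runs on the dangerous-set states of `…PcintNawRandMem` (`nstep τ`; states `danger τ`).  Reading letter `a` (new
vertex `e = stepVec a` relative to the current endpoint) it inspects every lattice neighbour `w = e + stepVec b ≠ 0` of the new
vertex: the VISIBLE INCIDENCES of `w` are the remembered sites adjacent to `w` (`cvis`); `w` is ACTIVE when some visible
incidence has age `j` with `j + 1 ≤ kc` (the new incidence is linked to it, `cactive`); an active `w` PAYS one unit, plus a BONUS
unit when the most recent visible incidence `j₁` is decidably unpaid: `j₁ + kc + 3 ≤ τ` and no visible incidence has age in
`(j₁, j₁ + kc]` (`cbonus`); the payment is UNCONDITIONAL when some visible incidence has age `≥ 3` (`cuncond`, a gap-`≥ 4` pair: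
the site is forced for every sibling order) and otherwise CONDITIONAL (then `w` is the corner site of the step and is forced exactly
when the corner is bad for the order; the corner site is recognised syntactically, `ccorner`).  `cu`/`cc` = unconditional /
conditional units of the step; the symmetric step factor is
`q^{cu} · ((1 + q^{cc})/2)^{[cc > 0]}` (`cwt`) and `chainMemAut τ kc p q` is the weighted automaton.  Soundness
(`…PcintNawChainMemSound`): along a neighbour-avoiding word the units paid in the world of an order `o` are distinct incidences of
`o`-forced sites, whence `θ^site(p) ≤ p · total n ∅` after averaging over `o`.
-/

noncomputable section

namespace Summit.CriticalPhenomena.PercolationContinuityZ3.Theorems.Pcint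

open Finset Literature.Probability.Percolation Literature.Probability.LatticeModels

variable {d : ℕ}

/-! ### Step data of the chain rule -/

section StepData

variable (τ kc : ℕ)

/-- The lattice neighbour of the new vertex `stepVec a` in direction `b`, relative to the current endpoint. [folklore] -/
def cnbr (a b : Fin d × Bool) : Site d := stepVec a + stepVec b

/-- The VISIBLE INCIDENCES of the neighbour site: remembered sites adjacent to it. [folklore] -/
def cvis (S : MState d) (a b : Fin d × Bool) : Finset (Site d × ℕ) := S.filter fun q => (zdGraph d).Adj q.1 (cnbr a b)

/-- Membership in `cvis`. [folklore] -/
theorem mem_cvis {S : MState d} {a b : Fin d × Bool} {q : Site d × ℕ} :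
    q ∈ cvis S a b ↔ q ∈ S ∧ (zdGraph d).Adj q.1 (cnbr a b) := mem_filter

/-- ACTIVE neighbour (Boolean): not the current endpoint, and linked — some visible incidence of age `j` with `j + 1 ≤ kc`.
[folklore] -/
def cactive (S : MState d) (a b : Fin d × Bool) : Bool := decide (cnbr a b ≠ 0 ∧ ∃ q ∈ cvis S a b, q.2 + 1 ≤ kc)

/-- UNCONDITIONAL (Boolean): some visible incidence has age `≥ 3` (a gap-`≥ 4` pair). [folklore] -/
def cuncond (S : MState d) (a b : Fin d × Bool) : Bool := decide (∃ q ∈ cvis S a b, 3 ≤ q.2)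

/-- BONUS WITNESS (Boolean): `q₁` is a visible incidence with `q₁.2 + kc + 3 ≤ τ` such that every visible incidence has age
`q₁.2` or age `> q₁.2 + kc` (so `q₁` is the most recent one and the `kc` indices before it are decidably free). [folklore] -/
def bonusWit (S : MState d) (a b : Fin d × Bool) (q₁ : Site d × ℕ) : Bool :=
  decide (q₁ ∈ cvis S a b ∧ q₁.2 + kc + 3 ≤ τ ∧ ∀ q ∈ cvis S a b, q.2 = q₁.2 ∨ q₁.2 + kc < q.2)

/-- BONUS (Boolean): some visible incidence is a bonus witness. [folklore] -/
def cbonus (S : MState d) (a b : Fin d × Bool) : Bool := decide (∃ q₁ ∈ cvis S a b, bonusWit τ kc S a b q₁ = true)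

/-- CORNER neighbour (Boolean): the neighbour in direction `b` is the corner site `r₁ + e` of the step, i.e. `stepVec b` is the
remembered age-1 site `r₁` (the previous vertex seen from the current one). [folklore] -/
def ccorner (S : MState d) (b : Fin d × Bool) : Bool := decide ((stepVec b, 1) ∈ S)

/-- What `ccorner = true` says. [folklore] -/
theorem ccorner_iff {S : MState d} {b : Fin d × Bool} : ccorner S b = true ↔ (stepVec b, 1) ∈ S := by
  unfold ccorner; rw [decide_eq_true_iff]

/-- What `cactive = true` says. [folklore] -/
theorem cactive_iff {S : MState d} {a b : Fin d × Bool} :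
    cactive kc S a b = true ↔ cnbr a b ≠ 0 ∧ ∃ q ∈ cvis S a b, q.2 + 1 ≤ kc := by
  unfold cactive; rw [decide_eq_true_iff]

/-- What `cuncond = true` says. [folklore] -/
theorem cuncond_iff {S : MState d} {a b : Fin d × Bool} : cuncond S a b = true ↔ ∃ q ∈ cvis S a b, 3 ≤ q.2 := by
  unfold cuncond; rw [decide_eq_true_iff]

/-- What `bonusWit = true` says. [folklore] -/
theorem bonusWit_iff {S : MState d} {a b : Fin d × Bool} {q₁ : Site d × ℕ} :
    bonusWit τ kc S a b q₁ = true ↔ q₁ ∈ cvis S a b ∧ q₁.2 + kc + 3 ≤ τ ∧ ∀ q ∈ cvis S a b, q.2 = q₁.2 ∨ q₁.2 + kc < q.2 := by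
  unfold bonusWit; rw [decide_eq_true_iff]

/-- What `cbonus = true` says. [folklore] -/
theorem cbonus_iff {S : MState d} {a b : Fin d × Bool} : cbonus τ kc S a b = true ↔ ∃ q₁, bonusWit τ kc S a b q₁ = true := by
  unfold cbonus; rw [decide_eq_true_iff]
  exact ⟨fun ⟨q₁, _, h⟩ => ⟨q₁, h⟩, fun ⟨q₁, h⟩ => ⟨q₁, ((bonusWit_iff τ kc).1 h).1, h⟩⟩

/-- Units paid at the neighbour in direction `b`: `0` if inactive, else `1 + [bonus]`. [folklore] -/
def cpay (S : MState d) (a b : Fin d × Bool) : ℕ :=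
  if cactive kc S a b then (if cbonus τ kc S a b then 2 else 1) else 0

/-- Unconditional units of the step. [folklore] -/
def cu (S : MState d) (a : Fin d × Bool) : ℕ := ∑ b : Fin d × Bool, if cuncond S a b then cpay τ kc S a b else 0

/-- Conditional (corner) units of the step: paid at the corner site when it is active and not unconditional.  (Active neighbours
that are neither unconditional nor the corner site do not occur along neighbour-avoiding words and pay nothing.) [folklore] -/
def cc (S : MState d) (a : Fin d × Bool) : ℕ :=
  ∑ b : Fin d × Bool, if !cuncond S a b && ccorner S b then cpay τ kc S a b else 0

/-- `cpay ≤ 2`. [folklore] -/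
theorem cpay_le_two (S : MState d) (a b : Fin d × Bool) : cpay τ kc S a b ≤ 2 := by
  unfold cpay; split_ifs <;> omega

/-- The symmetric step factor `q^{cu} · ((1+q^{cc})/2)^{[cc>0]}`. [folklore] -/
def cwt (q : ℝ) (S : MState d) (a : Fin d × Bool) : ℝ :=
  q ^ cu τ kc S a * (if cc τ kc S a = 0 then 1 else (1 + q ^ cc τ kc S a) / 2)

/-- The step factor is nonnegative. [folklore] -/
theorem cwt_nonneg {q : ℝ} (hq : 0 ≤ q) (S : MState d) (a : Fin d × Bool) : 0 ≤ cwt τ kc q S a := by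
  unfold cwt; split_ifs <;> positivity

/-- The step factor is at most one (for `0 ≤ q ≤ 1`). [folklore] -/
theorem cwt_le_one {q : ℝ} (hq : 0 ≤ q) (hq1 : q ≤ 1) (S : MState d) (a : Fin d × Bool) : cwt τ kc q S a ≤ 1 := by
  unfold cwt
  have h1 : q ^ cu τ kc S a ≤ 1 := pow_le_one₀ hq hq1
  split_ifs
  · rw [mul_one]; exact h1
  · have h2 : q ^ cc τ kc S a ≤ 1 := pow_le_one₀ hq hq1
    calc q ^ cu τ kc S a * ((1 + q ^ cc τ kc S a) / 2) ≤ 1 * 1 :=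
          mul_le_mul h1 (by linarith) (by positivity) zero_le_one
      _ = 1 := one_mul _

/-- **The B2c automaton on dangerous-set states** with weight `p · q^{cu} · ((1+q^{cc})/2)^{[cc>0]}`. [folklore] -/
def chainMemAut (p q : ℝ) (hp : 0 ≤ p) (hq : 0 ≤ q) : WAut (MState d) (Fin d × Bool) where
  step := nstep τ
  wt S a := p * cwt τ kc q S a
  wt_nonneg S a := mul_nonneg hp (cwt_nonneg τ kc hq S a)

end StepData

end Summit.CriticalPhenomena.PercolationContinuityZ3.Theorems.Pcint
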